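import Literature.IUT.LogVolume.SubThetaFieldRamificationWildLemmas
import HarnessLib

/-!
# The ramification of a field pinned by the v3 Θ-datum at a WILD bad place `v ∣ p ∈ {3, 5}`:
# `e(w | v) ∣ p·(p − 1)·p′` (`p′ = 15/p`), and `e(w | v) ∣ p·(p − 1)` when `p′ ∣ ord_v j(λ)` (proof-only)

J.-P. Serre, *Propriétés galoisiennes des points d'ordre fini des courbes elliptiques*, Invent. Math. **15** (1972),
§1.11 (`det ρ̄_p = χ̄_p`, the Weil pairing) and §1.12, Cor. of Prop. 13 («mauvaise réduction de type multiplicatif»: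
at a multiplicative place `v ∣ p` the inertia group acts on `E[p]` through `(χ *; 0 1)`, so its image has order
dividing `p(p − 1)`); §1.12 at `v ∤ p′` (inertia acts on `E[p′]` through `(1 *; 0 1)`, trivially iff
`p′ ∣ v(q)`); J.-P. Serre, *Local Fields*, IV §2; S. Mochizuki, *Inter-universal Teichmüller theory IV*, Thm. 1.10
Step (iii) (R2)–(R4) p. 25–26 (locus of use only: the per-place ramification budget of the layer `F/F_tpd`).

The landed LOCAL-TYPE files of the abc-iut R-W window table bound the layer `F/F_tpd` of a field pinned by
`IsSubThetaField P F` (`F ⊆ F_tpd(√−1, √λ, √(λ−1), E_λ[15])`, Galois over `F_tpd`) at the BAD places `v ∤ 30`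
(`SubThetaFieldRamificationSixty/Thirty/TateUnramified`: `e(w|v) ∣ 60 / 30 / 2·15/gcd(15, ord_v q)`). THIS FILE treats the
WILD bad places `v ∣ p`, `p ∈ {3, 5}`, at which `v` is unramified over `p` (`ord_v(p) = 1`, e.g. `F_tpd = ℚ`):

* `Cor22.ramificationIdx_subThetaField_dvd_wild_of_forall_inertia` — the abstract form: if on `I_𝔓 ∩ Γ_{F_tpd(√d)}`
  (`E_λ^{(d)}` a multiplicative twist at `v`) the tame representation satisfies `ρ̄_{E_λ,p′}(σ)^k = 1`, then
  **`e(w | v) ∣ p·(p − 1)·k`**;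
* **`Cor22.ramificationIdx_subThetaField_dvd_wild`** — `e(w | v) ∣ p·(p − 1)·p′` (`k = p′` by unipotence of tame
  inertia, abc-iut-L5-t12's `galoisRepTorsion_pow_eq_one_of_mem_inertia_of_hasMultiplicativeReductionAt_quadraticTwist`);
* **`Cor22.ramificationIdx_subThetaField_dvd_wild_of_dvd_ord`** — `p′ ∣ ord_v j(λ)` ⇒ `e(w | v) ∣ p·(p − 1)` (`k = 1` by
  the Tate criterion `galoisRepTorsion_eq_one_of_mem_inertia_of_dvd_ord`).

PROOF (inertia level; the bookkeeping of `SubThetaFieldRamificationSixty` with the wild step inserted). Let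
`I = I_𝔓` be the absolute inertia group at `v ∣ p`, `E′ = E_λ^{(d)}` a quadratic twist with multiplicative reduction at
`v` (`exists_hasMultiplicativeReductionAt_quadraticTwist_of_one_lt_valuation_j`), and `X ≤ E′[p]` Serre's line:
`#X ≤ p` and `τP − P ∈ X` for `τ ∈ I`, `P ∈ E′[p]` (the tree's `exists_addSubgroup_card_le_of_hasMultiplicativeReductionAt`,
proved there without the Tate curve). (1) `I` acts on `X` (a group of order `1` or `p`), so the pointwise fixer `A` of
`X` has `[I : I ∩ A] ∣ #Aut(X) ∣ p − 1`. (2) On `I ∩ A` every `ρ̄_{E′,p}(σ)` is unipotent (`(g − 1)E′[p] ⊆ X`,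
`(g − 1)X = 0`), so `[I ∩ A : I ∩ A ∩ ker ρ̄_{E′,p}] ∣ p` (`natCard_map_galoisRepTorsion_dvd_of_forall_pow_eq_one`).
(3) An element of `I ∩ ker ρ̄_{E′,p}` fixes the `p`-th roots of unity (Weil pairing `e_p(σS, σT) = σ e_p(S,T)`),
hence `√p*` (`p* = −3, 5`: `√−3 = 2ζ₃ + 1`, `√5 = 2(ζ₅ + ζ₅⁻¹) + 1`), hence EVERY square root of EVERY `a ∈ F_tpd^×`
(if `ord_v a` is even, inertia fixes `√a`; if odd, `ord_v(a·p*)` is even since `ord_v p = 1`) — in particular `√d`,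
`√−1`, `√λ`, `√(λ−1)` — so it lies in `Γ_{F_tpd(√d)} ∩ ker ρ̄_{E_λ,p}` (`ker_galoisRepTorsion_quadraticTwist_inf_stabilizer_le`),
and (4) `ρ̄_{E_λ,p′}` has exponent `k` there, giving the last factor `k`. Finally `e(w | v) = #I_w(Gal(F/F_tpd))` is the
order of the restriction of `I`, which divides `[I : I ∩ (gens-fixer)] ∣ (p − 1)·p·k`.

Numerically (abc-iut W-num-2 N1-WILD-EXACT L2–L4): `e(F_w/ℚ_p) ∣ p(p−1)·r`, `r = p′/gcd(p′, t)` at a pole of order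
`2t` — the UPPER half of the exact wild type `e = p(p − 1)·r` of GAP G-Wnum2-1 (i); the lower half is
`GenuineThetaFieldTateRoot` / `GenuineThetaFieldCyclotomicRamification`. Proof-only (no definition, no named fact);
classical; TAKES NO SIDE on [IUTchIII] Cor. 3.12.
-/

noncomputable section

open scoped Classical

namespace Literature.IUT.LogVolume

namespace Cor22

open NumberField IsDedekindDomain Literature.NumberTheory.DiophantineGeometry.GenEll
open Literature.NumberTheory.EllipticCurves Literature.NumberTheory.GaloisRepresentations
open Literature.NumberTheory.NumberFields WeierstrassCurve IntermediateField Field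

/-! ## §0c. Dictionary lemmas on `ord` -/

section Ord

variable {F₀ : Type*} [Field F₀] [NumberField F₀]

/-- `val_v(x) = exp(−ord_v x)` for `x ≠ 0`. [folklore] -/
private theorem valuation_eq_exp_neg_ord (v : HeightOneSpectrum (𝓞 F₀)) {x : F₀} (hx : x ≠ 0) :
    v.valuation F₀ x = WithZero.exp (-ord F₀ v x) := by
  have hne : v.valuation F₀ x ≠ 0 := by rwa [ne_eq, map_eq_zero]
  rw [ord, neg_neg, WithZero.exp_log hne]

/-- `ord_v(−x) = ord_v(x)`. [folklore] -/
private theorem ord_neg' (v : HeightOneSpectrum (𝓞 F₀)) (x : F₀) : ord F₀ v (-x) = ord F₀ v x := by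
  unfold ord; rw [Valuation.map_neg]

omit [NumberField F₀] in
/-- Two coprime natural numbers do not both lie in a proper ideal. [folklore] -/
private theorem natCast_not_mem_of_coprime (v : HeightOneSpectrum (𝓞 F₀)) {m p : ℕ} (hmp : Nat.Coprime m p)
    (hpv : ((p : ℕ) : 𝓞 F₀) ∈ v.asIdeal) : ((m : ℕ) : 𝓞 F₀) ∉ v.asIdeal := by
  intro hmv
  have hbez := Int.gcd_eq_gcd_ab (m : ℤ) (p : ℤ)
  rw [Int.gcd_natCast_natCast, hmp, Nat.cast_one] at hbez
  have h1 : ((1 : ℤ) : 𝓞 F₀) ∈ v.asIdeal := by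
    rw [hbez]
    push_cast
    exact v.asIdeal.add_mem (v.asIdeal.mul_mem_right _ hmv) (v.asIdeal.mul_mem_right _ hpv)
  rw [Int.cast_one] at h1
  exact v.isPrime.ne_top ((Ideal.eq_top_iff_one _).mpr h1)

end Ord

/-! ## §1. The divisibility `e(w | v) ∣ p·(p − 1)·k` at the wild bad places -/

variable {P : NFPoint} (F : Type) [Field F] [NumberField F] [Algebra P.F F]

/-- **The wild-inertia argument, abstract form: `e(w | v) ∣ p·(p − 1)·k`.** `P ∈ U`, `F` Galois over `F_tpd` with
`IsSubThetaField P F`, `w | v` with `v ∈ badPlaces P`, `v ∣ p`, `{p, q} = {3, 5}`, `v` UNRAMIFIED over `p` (`ord_v(p) = 1`, e.g.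
`F_tpd = ℚ`), and `k ∣ q`. Suppose that for every prime `𝔓 | v` of `\bar ℤ_{F_tpd}`, every `d ≠ 0` with `E_λ^{(d)}`
multiplicative at `v`, and every `σ ∈ I_𝔓` fixing `√d`, `ρ̄_{E_λ,q}(σ)^k = 1`. THEN `e(w | v) ∣ p·(p − 1)·k`:
`[I : I ∩ A] ∣ p − 1` for the pointwise fixer `A` of Serre's line `X ≤ E_λ^{(d)}[p]` (Cor. of Prop. 13),
`[I ∩ A : I ∩ A ∩ ker ρ̄_{E′,p}] ∣ p` (unipotence), every element of `I ∩ ker ρ̄_{E′,p}` fixes `μ_p` (Weil pairing), hence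
`√p*` and every square root of every `a ∈ F_tpd^×` (even order: inertia; odd order: partner `p*`), so lies in
`Γ_{F_tpd(√d)} ∩ ker ρ̄_{E_λ,p} ∩` the three quadratic fixers, where `ρ̄_{E_λ,q}` contributes the last factor `k`.
[cite: Serre1972, §1.11–§1.12] [cite: Mochizuki2012, IUTchIV Thm 1.10 proof Step (iii) (R2)–(R4) p.25–26] -/
theorem ramificationIdx_subThetaField_dvd_wild_of_forall_inertia (hU : P.InU) (hF : IsSubThetaField P F)
    [IsGalois P.F F] (w : HeightOneSpectrum (𝓞 F)) (hbad : finBelow P.F F w ∈ badPlaces P)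
    {p q : ℕ} (hpq : (p = 3 ∧ q = 5) ∨ (p = 5 ∧ q = 3))
    (hpv : ((p : ℕ) : 𝓞 P.F) ∈ (finBelow P.F F w).asIdeal)
    (hp1 : ord P.F (finBelow P.F F w) (p : P.F) = 1) {k : ℕ} (hk : k ∣ q)
    (H : ∀ (𝔓 : Ideal (absIntegers (𝓞 P.F) P.F)), 𝔓 ∈ (finBelow P.F F w).primesAbove → ∀ (d : P.F), d ≠ 0 →
      (P.legendreCurve.quadraticTwist d).HasMultiplicativeReductionAt (finBelow P.F F w) →
      ∀ σ ∈ 𝔓.inertia (absoluteGaloisGroup P.F), σ • geomSqrt d = geomSqrt d →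
        P.legendreCurve.galoisRepTorsion ((q : ℕ) : ℤ) σ ^ k = 1) :
    w.asIdeal.ramificationIdx (𝓞 P.F) ∣ p * (p - 1) * k := by
  haveI : P.legendreCurve.IsElliptic := P.legendreCurve_isElliptic_iff.2 hU
  have hp : p.Prime := by rcases hpq with ⟨rfl, -⟩ | ⟨rfl, -⟩ <;> norm_num
  have hq : q.Prime := by rcases hpq with ⟨-, rfl⟩ | ⟨-, rfl⟩ <;> norm_num
  haveI : Fact p.Prime := ⟨hp⟩
  haveI : Fact q.Prime := ⟨hq⟩
  haveI : Fact (Nat.Prime 3) := ⟨Nat.prime_three⟩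
  haveI : Fact (Nat.Prime 5) := ⟨Nat.prime_five⟩
  haveI : NeZero (p : P.F) := ⟨Nat.cast_ne_zero.mpr hp.ne_zero⟩
  have hp2 : p ≠ 2 := by rcases hpq with ⟨rfl, -⟩ | ⟨rfl, -⟩ <;> norm_num
  set v := finBelow P.F F w with hvdef
  haveI := v.isPrime
  -- residue characteristic `p`: `2 ∉ v`, `q ∉ v`
  have h2 : ((2 : ℕ) : 𝓞 P.F) ∉ v.asIdeal :=
    natCast_not_mem_of_coprime v (by rcases hpq with ⟨rfl, -⟩ | ⟨rfl, -⟩ <;> norm_num) hpv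
  have h2' : (2 : 𝓞 P.F) ∉ v.asIdeal := by exact_mod_cast h2
  have hqv : ((q : ℕ) : 𝓞 P.F) ∉ v.asIdeal :=
    natCast_not_mem_of_coprime v (by rcases hpq with ⟨rfl, rfl⟩ | ⟨rfl, rfl⟩ <;> norm_num) hpv
  -- `F ≃ L := F_tpd(φ S) ⊆ F̄_tpd`
  haveI : FiniteDimensional P.F F := Module.Finite.of_restrictScalars_finite ℚ P.F F
  set Ω := AlgebraicClosure P.F
  let φ : F →ₐ[P.F] Ω := IsAlgClosed.lift
  set S : Set F := subThetaFieldGenerators P F with hSdef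
  set L : IntermediateField P.F Ω := IntermediateField.adjoin P.F (φ '' S) with hLdef
  have hL : φ.fieldRange = L := by
    rw [AlgHom.fieldRange_eq_map, ← hF.adjoin_eq_top, IntermediateField.adjoin_map]
  let e : F ≃ₐ[P.F] L :=
    (((IntermediateField.topEquiv (F := P.F) (E := F)).symm.trans (IntermediateField.equivMap ⊤ φ)).trans
      (IntermediateField.equivOfEq (AlgHom.fieldRange_eq_map φ).symm)).trans
      (IntermediateField.equivOfEq hL)
  haveI : FiniteDimensional P.F L := LinearEquiv.finiteDimensional e.toLinearEquiv
  haveI : IsGalois P.F L := IsGalois.of_algEquiv e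
  haveI : NumberField L := NumberField.of_module_finite P.F L
  -- absolute inertia at `v`
  obtain ⟨𝔓, h𝔓⟩ := HeightOneSpectrum.primesAbove_nonempty v
  haveI : 𝔓.IsPrime := h𝔓.1
  haveI : 𝔓.LiesOver v.asIdeal := h𝔓.2
  set I : Subgroup (absoluteGaloisGroup P.F) := 𝔓.inertia (absoluteGaloisGroup P.F) with hIdef
  -- a multiplicative quadratic twist `E′ = E_λ^{(d)}` at the bad place `v`
  have hord : ord P.F v (jInv P.x) < 0 := (mem_badPlaces_iff_ord_neg P v).1 hbad
  have hj0 : jInv P.x ≠ 0 := fun h0 => by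
    rw [h0, ord_zero] at hord
    exact lt_irrefl _ hord
  have hj : 1 < v.valuation P.F P.legendreCurve.j := by
    rw [j_legendre P hU]
    exact (ord_neg_iff_one_lt_valuation P.F v hj0).1 hord
  obtain ⟨d, hd, hmult⟩ :=
    P.legendreCurve.exists_hasMultiplicativeReductionAt_quadraticTwist_of_one_lt_valuation_j v hj
  haveI : (P.legendreCurve.quadraticTwist d).IsElliptic := P.legendreCurve.isElliptic_quadraticTwist hd
  set E' : WeierstrassCurve P.F := P.legendreCurve.quadraticTwist d with hE'def
  -- Serre's line `X ≤ E′[p]`: `#X ≤ p`, `τ P − P ∈ X` for `τ ∈ I`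
  obtain ⟨X, hXcard, hX⟩ := E'.exists_addSubgroup_card_le_of_hasMultiplicativeReductionAt hp2 hpv hmult h𝔓
  have hXp : Nat.card X ∣ p := by
    have hdvd : Nat.card X ∣ p ^ 2 := by
      rw [← Literature.NumberTheory.EllipticCurves.natCard_geomTorsion E' p]
      exact AddSubgroup.card_addSubgroup_dvd_card X
    obtain ⟨i, hi, hXi⟩ := (Nat.dvd_prime_pow hp).mp hdvd
    rw [hXi] at hXcard ⊢
    interval_cases i
    · simp
    · simp
    · exfalso
      have := hp.one_lt
      nlinarith [hXcard]
  -- (a) the pointwise fixer `A` of `X` in `I`: `[I : A] ∣ p − 1`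
  have hIX : ∀ σ ∈ I, ∀ x ∈ X, σ • x ∈ X := fun σ hσ x hx => by
    have h := hX σ hσ x
    have hx' : σ • x = (σ • x - x) + x := by abel
    rw [hx']
    exact X.add_mem h hx
  obtain ⟨A, hAI, hArel, hAfix, -⟩ := E'.exists_subgroup_fixing_relIndex_dvd hp X hXp I hIX
  -- (b) `K′ = ker ρ̄_{E′,p}` has index `∣ p` in `A` (unipotence)
  set K' : Subgroup (absoluteGaloisGroup P.F) := (E'.galoisRepTorsion (p : ℤ)).ker with hK'
  have hK'r : K'.relIndex A ∣ p := by
    rw [hK', Subgroup.relIndex_ker]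
    exact E'.natCard_map_galoisRepTorsion_dvd_of_forall_pow_eq_one hp A fun σ hσ =>
      E'.galoisRepTorsion_pow_eq_one_of_sub_mem_of_forall_smul_eq X (fun Q => hX σ (hAI hσ) Q) (hAfix σ hσ)
  -- (c) an element of `K′ ∩ I` fixes every square root of every `a ∈ F_tpd^×`
  have hsqrt : ∀ σ ∈ K' ⊓ I, ∀ a : P.F, a ≠ 0 → ∀ z : AlgebraicClosure P.F,
      z ^ 2 = algebraMap P.F (AlgebraicClosure P.F) a → σ • z = z := by
    intro σ hσ a ha z hz
    have hζ : ∀ ζ : AlgebraicClosure P.F, ζ ^ p = 1 → σ • ζ = ζ := fun ζ hζ =>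
      E'.smul_eq_of_pow_prime_eq_one_of_mem_ker_galoisRepTorsion hp hσ.1 hζ
    -- the partner `p* ∈ {−3, 5}`: `ord_v p* = 1` and `σ` fixes `√p*`
    obtain ⟨ps, hps0, hps1, hpsfix⟩ : ∃ ps : P.F, ps ≠ 0 ∧ ord P.F v ps = 1 ∧
        ∀ z₀ : AlgebraicClosure P.F, z₀ ^ 2 = algebraMap P.F (AlgebraicClosure P.F) ps → σ • z₀ = z₀ := by
      rcases hpq with ⟨rfl, -⟩ | ⟨rfl, -⟩
      · refine ⟨-3, by norm_num, ?_, fun z₀ hz₀ => smul_eq_of_sq_eq_neg_three hζ hz₀⟩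
        rw [show (-3 : P.F) = -((3 : ℕ) : P.F) by norm_num, ord_neg']
        exact hp1
      · refine ⟨5, by norm_num, ?_, fun z₀ hz₀ => smul_eq_of_sq_eq_five hζ hz₀⟩
        exact_mod_cast hp1
    rcases Int.even_or_odd (ord P.F v a) with ⟨m, hm⟩ | ⟨m, hm⟩
    · -- even order: inertia fixes `√a`
      have hval : v.valuation P.F a = WithZero.exp (2 * (-m)) := by
        rw [valuation_eq_exp_neg_ord v ha, hm]
        congr 1
        ring
      exact smul_eq_of_mem_inertia_of_sq_eq_of_valuation_eq_exp_even v h𝔓 hσ.2 h2' hval hz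
    · -- odd order: `a·p*` has even order
      have hval : v.valuation P.F (a * ps) = WithZero.exp (2 * (-(m + 1))) := by
        rw [valuation_eq_exp_neg_ord v (mul_ne_zero ha hps0), ord_mul P.F v ha hps0, hm, hps1]
        congr 1
        ring
      exact smul_eq_of_sq_eq_of_valuation_mul_eq_exp_even v h𝔓 hσ.2 h2' hps0 hval hpsfix hz
  -- hence `K′ ∩ I ≤ Γ_{F_tpd(√d)} ∩ ker ρ̄_{E_λ,p}`
  have hNd : ∀ σ ∈ K' ⊓ I, σ • geomSqrt d = geomSqrt d := fun σ hσ => hsqrt σ hσ d hd _ (geomSqrt_sq d)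
  have hKp : ∀ σ ∈ K' ⊓ I, σ ∈ (P.legendreCurve.galoisRepTorsion (p : ℤ)).ker := fun σ hσ =>
    P.legendreCurve.ker_galoisRepTorsion_quadraticTwist_inf_stabilizer_le (p : ℤ) hd
      (Subgroup.mem_inf.2 ⟨hσ.1, MulAction.mem_stabilizer_iff.2 (hNd σ hσ)⟩)
  -- (e) `Kq = ker ρ̄_{E_λ,q}` has index `∣ k` in `K′ ∩ A`
  set Kq : Subgroup (absoluteGaloisGroup P.F) := (P.legendreCurve.galoisRepTorsion (q : ℤ)).ker with hKq
  have hKqr : Kq.relIndex (K' ⊓ A) ∣ k := by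
    rw [hKq, Subgroup.relIndex_ker]
    refine P.legendreCurve.natCard_map_galoisRepTorsion_dvd_of_forall_pow_eq_one_of_dvd hq hk (K' ⊓ A)
      fun σ hσ => ?_
    have hσI : σ ∈ K' ⊓ I := ⟨hσ.1, hAI hσ.2⟩
    exact H 𝔓 h𝔓 d hd hmult σ hσI.2 (hNd σ hσI)
  -- (f) `[I : Kq ∩ K′ ∩ A] ∣ k · p · (p − 1)`
  have hchain : (Kq ⊓ K' ⊓ A).relIndex I ∣ p * (p - 1) * k := by
    rw [← Subgroup.relIndex_inf_mul_relIndex (Kq ⊓ K') A I, ← Subgroup.relIndex_inf_mul_relIndex Kq K' (A ⊓ I),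
      inf_eq_left.mpr hAI]
    calc Kq.relIndex (K' ⊓ A) * K'.relIndex A * A.relIndex I ∣ k * p * (p - 1) :=
          mul_dvd_mul (mul_dvd_mul hKqr hK'r) hArel
      _ = p * (p - 1) * k := by ring
  -- (3) the gens-fixer `Hg ≤ Gal(F̄_tpd/L)` (as in `SubThetaFieldRamificationSixty`)
  set K3 : Subgroup (absoluteGaloisGroup P.F) := (P.legendreCurve.galoisRepTorsion ((3 : ℕ) : ℤ)).ker with hK3
  set K5 : Subgroup (absoluteGaloisGroup P.F) := (P.legendreCurve.galoisRepTorsion ((5 : ℕ) : ℤ)).ker with hK5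
  set Hg : Subgroup (absoluteGaloisGroup P.F) :=
    K3 ⊓ K5 ⊓ (sqrtFixer P (-1) ⊓ (sqrtFixer P P.x ⊓ sqrtFixer P (P.x - 1))) with hHgdef
  have hHN : Hg ≤ L.fixingSubgroup := by
    intro τ hτ
    refine mem_fixingSubgroup_adjoin_of_forall_eq (σ := Field.absoluteGaloisGroup.toAlgEquiv P.F τ) fun s hs => ?_
    obtain ⟨x, hx, rfl⟩ := hs
    rcases hx with (hsq | hsq | hsq) | htor
    · have : (φ x) ^ 2 = algebraMap P.F Ω (-1) := by rw [← map_pow, hsq, map_neg, map_one, map_neg, map_one]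
      exact forall_eq_of_mem_fixingSubgroup_adjoin hτ.2.1 _ this
    · have : (φ x) ^ 2 = algebraMap P.F Ω P.x := by rw [← map_pow, hsq, φ.commutes]
      exact forall_eq_of_mem_fixingSubgroup_adjoin hτ.2.2.1 _ this
    · have : (φ x) ^ 2 = algebraMap P.F Ω (P.x - 1) := by
        rw [← map_pow, hsq, map_sub, map_one, φ.commutes, map_sub, map_one]
      exact forall_eq_of_mem_fixingSubgroup_adjoin hτ.2.2.2 _ this
    · rw [torsionCoords_eq] at htor
      obtain ⟨T, hT, hxT⟩ := Set.mem_iUnion₂.1 htor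
      have hT15 : (15 : ℤ) • T = 0 := hT
      let T' : geomPoints P.legendreCurve := Affine.Point.map (W' := P.legendreCurve.toAffine) φ T
      have hT' : (15 : ℤ) • T' = 0 := by
        change (15 : ℤ) • Affine.Point.map (W' := P.legendreCurve.toAffine) φ T = 0
        rw [← map_zsmul, hT15, map_zero]
      have h3' : ∀ Q : geomTorsion P.legendreCurve ((3 : ℕ) : ℤ), τ • Q = Q := by
        intro Q
        have hQ := galoisRepTorsion_apply P.legendreCurve ((3 : ℕ) : ℤ) τ Q
        rw [(MonoidHom.mem_ker).1 hτ.1.1] at hQ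
        exact hQ.symm
      have h5' : ∀ Q : geomTorsion P.legendreCurve ((5 : ℕ) : ℤ), τ • Q = Q := by
        intro Q
        have hQ := galoisRepTorsion_apply P.legendreCurve ((5 : ℕ) : ℤ) τ Q
        rw [(MonoidHom.mem_ker).1 hτ.1.2] at hQ
        exact hQ.symm
      have hfix : τ • T' = T' := smul_eq_of_fifteen τ h3' h5' T' hT'
      refine forall_coords_of_smul_eq P τ T' hfix (φ x) ?_
      rcases T with _ | ⟨a, b, hab⟩
      · simp [pointCoords] at hxT
      · change φ x ∈ pointCoords (Affine.Point.map (W' := P.legendreCurve.toAffine) φ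
          (Affine.Point.some a b hab))
        rw [Affine.Point.map_some]
        simp only [pointCoords, Set.mem_insert_iff, Set.mem_singleton_iff] at hxT ⊢
        rcases hxT with rfl | rfl
        · exact Or.inl rfl
        · exact Or.inr rfl
  -- `Kq ∩ K′ ∩ A ∩ I ≤ Hg`, so `[I : Hg ∩ I] ∣ p(p−1)k`
  have hHr : Hg.relIndex I ∣ p * (p - 1) * k := by
    have hle : Kq ⊓ K' ⊓ A ⊓ I ≤ Hg := by
      intro τ hτ
      have hτKI : τ ∈ K' ⊓ I := ⟨hτ.1.1.2, hτ.2⟩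
      have hτp := hKp τ hτKI
      have hτq : τ ∈ Kq := hτ.1.1.1
      have h35 : τ ∈ K3 ∧ τ ∈ K5 := by
        rcases hpq with ⟨rfl, rfl⟩ | ⟨rfl, rfl⟩
        · exact ⟨hτp, hτq⟩
        · exact ⟨hτq, hτp⟩
      have hsq : ∀ a : P.F, a ≠ 0 → τ ∈ sqrtFixer P a := fun a ha =>
        mem_fixingSubgroup_adjoin_of_forall_eq (σ := Field.absoluteGaloisGroup.toAlgEquiv P.F τ)
          fun z hz => hsqrt τ hτKI a ha z hz
      exact ⟨⟨h35.1, h35.2⟩, hsq (-1) (by norm_num), hsq P.x hU.1, hsq (P.x - 1) (sub_ne_zero.mpr hU.2)⟩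
    have h := Subgroup.relIndex_dvd_of_le_left I hle
    rw [Subgroup.inf_relIndex_right] at h
    exact h.trans hchain
  -- (5) `e(w | v)`, read on the inertia group of `Gal(L/F_tpd)`, divides `[I : I ∩ Gal(F̄/L)] ∣ [I : I ∩ Hg]`
  set Q : Ideal (𝓞 L) := w.asIdeal.map (RingOfIntegers.mapAlgEquiv e : 𝓞 F ≃ₐ[𝓞 P.F] 𝓞 L) with hQ
  haveI : Q.IsPrime := isPrime_map_mapAlgEquiv e w
  haveI : Q.LiesOver v.asIdeal := liesOver_map_mapAlgEquiv e w _
  rw [← ramificationIdx_map_mapAlgEquiv e w]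
  set r : absoluteGaloisGroup P.F →* (L ≃ₐ[P.F] L) := AlgEquiv.restrictNormalHom L with hr
  have hker : r.ker = L.fixingSubgroup := IntermediateField.restrictNormalHom_ker L
  have h1 : (𝔓.comap (ringOfIntegersToIntegralClosure (k := P.F) (Ω := Ω) L)).inertia (L ≃ₐ[P.F] L) ≤
      I.map r := by
    intro g hg
    obtain ⟨σ, hσ, hσg⟩ := @exists_mem_inertia_restrict_eq P.F _ _ L _ _ 𝔓 h𝔓.1 g hg
    refine ⟨σ, hσ, AlgEquiv.ext fun x => Subtype.ext ?_⟩
    change (algebraMap L Ω) ((σ.restrictNormal L) x) = (algebraMap L Ω) (g x)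
    rw [AlgEquiv.restrictNormal_commutes]
    exact hσg x
  have key : Q.ramificationIdx (𝓞 P.F) ∣ p * (p - 1) * k := by
    rw [@ramificationIdx_eq_card_inertia_comap P.F _ _ L _ _ v 𝔓 h𝔓.1 h𝔓.2 Q _ _]
    have hdvd : Nat.card ((𝔓.comap (ringOfIntegersToIntegralClosure (k := P.F) (Ω := Ω) L)).inertia
        (L ≃ₐ[P.F] L)) ∣ L.fixingSubgroup.relIndex I := by
      have h := Subgroup.card_dvd_of_le h1
      rwa [← Subgroup.relIndex_ker I r, hker] at h
    exact hdvd.trans ((Subgroup.relIndex_dvd_of_le_left I hHN).trans hHr)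
  exact key

/-- **`e(w | v) ∣ p·(p − 1)·p′`** for every place `w` of a field pinned by `IsSubThetaField P F` (Galois over `F_tpd`) over a
BAD place `v ∣ p ∈ {3, 5}` of `λ` that is unramified over `p` (`{p, p′} = {3, 5}`): the tame representation `ρ̄_{E_λ,p′}` is
unipotent along inertia on `Γ_{F_tpd(√d)}` (abc-iut-L5-t12's
`galoisRepTorsion_pow_eq_one_of_mem_inertia_of_hasMultiplicativeReductionAt_quadraticTwist`), so `k = p′`. Numerically
`e ∣ 30` at `v ∣ 3`, `e ∣ 60` at `v ∣ 5` — the UPPER half of the wild local type `e(F_w/ℚ_p) = p(p−1)·r` of the abc-iut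
R-W window table (W-num-2 N1-WILD-EXACT L2–L4; GAP G-Wnum2-1 (i)).
[cite: Serre1972, §1.11–§1.12] [cite: Mochizuki2012, IUTchIV Thm 1.10 proof Step (iii) (R2)–(R4) p.25–26] -/
theorem ramificationIdx_subThetaField_dvd_wild (hU : P.InU) (hF : IsSubThetaField P F) [IsGalois P.F F]
    (w : HeightOneSpectrum (𝓞 F)) (hbad : finBelow P.F F w ∈ badPlaces P)
    {p q : ℕ} (hpq : (p = 3 ∧ q = 5) ∨ (p = 5 ∧ q = 3))
    (hpv : ((p : ℕ) : 𝓞 P.F) ∈ (finBelow P.F F w).asIdeal)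
    (hp1 : ord P.F (finBelow P.F F w) (p : P.F) = 1) :
    w.asIdeal.ramificationIdx (𝓞 P.F) ∣ p * (p - 1) * q := by
  haveI : P.legendreCurve.IsElliptic := P.legendreCurve_isElliptic_iff.2 hU
  have hq : q.Prime := by rcases hpq with ⟨-, rfl⟩ | ⟨-, rfl⟩ <;> norm_num
  have hqv : ((q : ℕ) : 𝓞 P.F) ∉ (finBelow P.F F w).asIdeal :=
    natCast_not_mem_of_coprime _ (by rcases hpq with ⟨rfl, rfl⟩ | ⟨rfl, rfl⟩ <;> norm_num) hpv
  exact ramificationIdx_subThetaField_dvd_wild_of_forall_inertia F hU hF w hbad hpq hpv hp1 (dvd_refl q)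
    fun 𝔓 h𝔓 d hd hmult σ hσ hσd =>
      P.legendreCurve.galoisRepTorsion_pow_eq_one_of_mem_inertia_of_hasMultiplicativeReductionAt_quadraticTwist
        hq hd hmult hqv h𝔓 hσ hσd

/-- **`p′ ∣ ord_v j(λ)` ⇒ `e(w | v) ∣ p·(p − 1)`** (`v ∣ p ∈ {3, 5}` a bad place of `λ` unramified over `p`, `{p, p′} =
{3, 5}`): `ρ̄_{E_λ,p′}` is TRIVIAL along inertia on `Γ_{F_tpd(√d)}` by the Tate criterion
(`galoisRepTorsion_eq_one_of_mem_inertia_of_dvd_ord`), so `k = 1`. Numerically `e ∣ 6` at `v ∣ 3` when `5 ∣ ord_v q`,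
`e ∣ 20` at `v ∣ 5` when `3 ∣ ord_v q` (the case `r = 1` of the wild local type).
[cite: Serre1972, §1.11–§1.12] [cite: Mochizuki2012, IUTchIV Thm 1.10 proof Step (iii) (R2)–(R4) p.25–26] -/
theorem ramificationIdx_subThetaField_dvd_wild_of_dvd_ord (hU : P.InU) (hF : IsSubThetaField P F) [IsGalois P.F F]
    (w : HeightOneSpectrum (𝓞 F)) (hbad : finBelow P.F F w ∈ badPlaces P)
    {p q : ℕ} (hpq : (p = 3 ∧ q = 5) ∨ (p = 5 ∧ q = 3))
    (hpv : ((p : ℕ) : 𝓞 P.F) ∈ (finBelow P.F F w).asIdeal)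
    (hp1 : ord P.F (finBelow P.F F w) (p : P.F) = 1)
    (hqord : (q : ℤ) ∣ ord P.F (finBelow P.F F w) (jInv P.x)) :
    w.asIdeal.ramificationIdx (𝓞 P.F) ∣ p * (p - 1) := by
  haveI : P.legendreCurve.IsElliptic := P.legendreCurve_isElliptic_iff.2 hU
  have hq : q.Prime := by rcases hpq with ⟨-, rfl⟩ | ⟨-, rfl⟩ <;> norm_num
  have hqv : ((q : ℕ) : 𝓞 P.F) ∉ (finBelow P.F F w).asIdeal :=
    natCast_not_mem_of_coprime _ (by rcases hpq with ⟨rfl, rfl⟩ | ⟨rfl, rfl⟩ <;> norm_num) hpv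
  have h := ramificationIdx_subThetaField_dvd_wild_of_forall_inertia F hU hF w hbad hpq hpv hp1 (one_dvd q)
    fun 𝔓 h𝔓 d hd hmult σ hσ hσd => by
      rw [pow_one]
      exact galoisRepTorsion_eq_one_of_mem_inertia_of_dvd_ord hU hq hqv hqord hd hmult h𝔓 hσ hσd
  simpa using h

end Cor22

end Literature.IUT.LogVolume

end
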